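import Summits.ABC.IUTFork.Repair.CandJoshi24Hull
import Summits.ABC.IUTFork.Repair.CandJoshi23Profile
import HarnessLib

/-!
# IUT REPAIR BRANCH (LADDER-ABC:A2.RP), class (iii) JOSHI, j2 — «VAL(U)» IV: THE CLASS-(iii) COLUMN on the value chart AS A FUNCTION
# OF THE SCALAR GROUP `U` — the whole column is TWO BITS: «`U ≠ ⊥`» and «`¼ ∈ U`»

Record file of the abc-iut cell's IUT REPAIR BRANCH (seat abc-iut-rp-j2, gen 3; rows RP-J01/J02 (abc-iut-rp-j1), RP-J03/J05 (rp-j2),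
BAR-V; sequel to `CandJoshi24Hull` p445199 and the one-bed VAL column `CandJoshi23Profile` p439782/p441100). TAKES NO SIDE on [IUTchIII]
Cor. 3.12 or on any author. PROOF-ONLY (no `def`); interface-level toy over `toyIndex` (`l⋇ = 2`); typed ≠ proved ≠ endorsed.
RESULTS — for every subgroup `U ≤ ℚˣ` of POSITIVE scalars (value chart `uSetting p U`, reading `uRho`, honest q-datum `uQDatum`; the row
predicates of `CandJoshi1` / `CandJoshi3` / `CandJoshi21` / `Barrier` cited BY NAME):
* **RESIDUAL BIT «`¼ ∈ U`»**: S (`u_residual_iff`, Hull file) ⟺ C `PilotKummerCompat` (`u_pilotKummerCompat_iff`) ⟺ H_J21-2 ⟺ `GapA3`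
  (`u_gapA3_iff`) ⟺ `¼ ∈ U`;
* **STATEMENT BIT «`U ≠ ⊥`»**: the typed Statement (`u_statement_iff`, Hull file) ⟺ `Licence` (`u_licence_iff`) ⟺ `GapH3` ⟺ H_J21-4
  `JoshiLocalPrototype` (`u_localPrototype_iff`) ⟺ **H_J1 `JoshiDominance` (`u_joshiDominance_iff`) ⟺ H_J2 `JoshiVolumeDominance` ⟺ H_J3
  `LocusCovers` (`u_locusCovers_iff`)** ⟺ H_J21-5 ⟺ ¬(Step (x) invariance) ⟺ `U ≠ ⊥` — the INTERMEDIATE suppliers of rows RP-J01/J02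
  (S ⟹ H_J1 ⟹ H_J3 ⟹ Hull ⟹ Statement, strict on the beds of record) side with the IDLE Statement bit, NOT with the residual bit: on
  `⟨16⟩` they all HOLD while S FAILS (`sixteen_intermediate_cells`);
* **NO BIT (independent of `U`)**: H_J21-1 `JoshiAnsatzQReading` ✗, H_J21-3 `JoshiTopNormalized` ✗, BAR-V `VolumePinned` ✗, H_J3′
  `ShellFilling` ✗ (the unit shell is never a possible image), and ✓: typed Thm. 3.11, the three pins, BridgeHyps, Step (x) hAdm.
`u_column_two_bits` packages the column. CENSUS SENTENCE (neutral): on the value chart the class-(iii) census — and the hull/Statement rows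
with it — is a function of two bits of the indeterminacy scalar group; Joshi's dominance / locus-covering / local-prototype readings and the
hull licence are EQUIVALENT to the idle typed Statement there (true for every non-isometric group, −|log(Θ)| = 0), and strictly weaker than
the residual (¼ ∈ U). [claim: Mochizuki2012, status: disputed] [claim: Joshi2023ATS2Local, status: disputed] [claim: Joshi2024ATSIII,
status: disputed] [claim: Joshi2021ATSII, status: disputed]
-/

noncomputable section

open Set

namespace Summit.ABC.IUTFork.Repair.CandJoshi24

open Thm311 Cor312 Cor312.Checks Cor312.IdentifiedNonVacuity Cor312Vol Cor312Vol.NaiveWitness Cor312Vol.UnitWitness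
  Cor312Vol.PinnedWitness Literature.IUT.LogThetaLattice Summit.ABC.IUTFork.Repair Summit.ABC.IUTFork.Repair.ScalarShells
  Summit.ABC.IUTFork.Repair.ScalarShellsThm311

variable (p : ℕ) (U : Subgroup ℚˣ)

/-! ## 1. The residual bit «¼ ∈ U»: C and GapA3 -/

/-- **C `PilotKummerCompat` on VAL(U) ⟺ `¼ ∈ U`** (abc-iut-rp-j2's `scalingIndeterminacy_iff_pilotKummerCompat` under (ii)(b) + `u_H2_iff`;
any `U ≤ ℚˣ`). [claim: Mochizuki2012, status: disputed] -/
theorem u_pilotKummerCompat_iff :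
    PilotKummerCompat (uFull p U).toLatticeSituation (uSetting p U) (uQDatum p U) ↔ CandJoshi23.quarter ∈ U := by
  rw [← scalingIndeterminacy_iff_pilotKummerCompat _ _ _ (u_kummerB p U 0), u_H2_iff]

/-- **`GapA3` on VAL(U) ⟺ `¼ ∈ U`** (the pins hold, so `GapA3` ⟺ S). [claim: Mochizuki2012, status: disputed] -/
theorem u_gapA3_iff (hU : U ≤ Units.posSubgroup ℚ) :
    GapA3 (uFull p U).toLatticeSituation (uSetting p U) (uRho p U) (uQDatum p U) ↔ CandJoshi23.quarter ∈ U := by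
  rw [gapA3_iff _ _ _ _ (u_kummerB p U 0), ← u_residual_iff p U hU]
  exact ⟨fun h => h (u_pinnedRegions3 p U hU), fun h _ => h⟩

/-! ## 2. No bit: the identification rows fail for EVERY `U` -/

/-- `H_1 ⊄ H_4` at label `2`: the point of valuation `1` lies in `H_1`, not in `H_4`. [folklore] -/
theorem uHalf_one_not_subset_four : ¬ uHalf p U 2 () 1 ⊆ uHalf p U 2 () ((jsq (2 : toyIndex.Label) : ℤ) : ℚ) := fun h => by
  have h1 := le_of_uHalf_subset p U h
  rw [jsq_two] at h1
  linarith

/-- The column-`m` Kummer image of the Θ-splitting monoid is the Θ-tuple datum, every `m` ((ii)(b)). [folklore] -/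
theorem u_frobΨ (m : ℤ) : ((uFull p U).toLatticeSituation.col (uSetting p U).n).frobΨ m = fun v _ => uPsi p U v := rfl

/-- The line-`n` splitting monoid is the Θ-tuple datum. [folklore] -/
theorem u_Ψ : ((uFull p U).toLatticeSituation.D (uSetting p U).n).Ψ = fun v _ => uPsi p U v := rfl

/-- **H_J21-1 `JoshiAnsatzQReading` FAILS on VAL(U), every `U`** (`ρ(q_K) = H_1 ≠ H_4 = ρ(Ψ_n)` at label `2`). [claim: Joshi2023ATS2Local, status: disputed] -/
theorem u_not_ansatzQReading : ¬ JoshiAnsatzQReading (uFull p U).toLatticeSituation (uSetting p U) (uRho p U) (uQDatum p U) := fun h => by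
  have h2 := h 2 ()
  rw [u_Ψ, uRho_uPsi, uRho_uQDatum, if_neg two_ne_zero_label] at h2
  exact uHalf_one_not_subset_four p U h2.subset

/-- **H_J21-3 `JoshiTopNormalized` FAILS on VAL(U), every `U`** (honest direction). [claim: Joshi2023ATS2Local, status: disputed] -/
theorem u_not_topNormalized : ¬ JoshiTopNormalized (uFull p U).toLatticeSituation (uSetting p U) (uRho p U) (uQDatum p U) := fun h => by
  have h2 := h 2 ()
  rw [u_Ψ, uRho_uPsi, uRho_uQDatum, if_neg two_ne_zero_label] at h2
  exact uHalf_one_not_subset_four p U h2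

/-- **BAR-V `VolumePinned` FAILS on VAL(U), every `U`** (`μ(H_1) = −log p ≠ −4·log p = μ(H_4)` at label `2`) — also where S holds (`¼ ∈ U`):
the volume mechanism needs Step (x), i.e. `U = ⊥`, where S fails. [claim: Mochizuki2012, status: disputed] -/
theorem u_not_volumePinned [Fact p.Prime] :
    ¬ VolumePinned (uFull p U).toLatticeSituation (uSetting p U) (uRho p U) (uQDatum p U) := fun h => by
  have h2 := h 2 ()
  rw [u_Ψ, uRho_uPsi, uRho_uQDatum, if_neg two_ne_zero_label] at h2
  have h2' : uVol p U 2 () (uHalf p U 2 () 1) = uVol p U 2 () (uHalf p U 2 () ((jsq (2 : toyIndex.Label) : ℤ) : ℚ)) := h2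
  have h3 := eq_of_uVol_uHalf_eq p U h2'
  rw [jsq_two] at h3
  norm_num at h3

/-- Every possible image at a label of `𝔽_l^⋇` is a half-line of POSITIVE threshold `u·j²`, `u ∈ U` — so the unit shell `H_0` is never one.
[folklore] -/
theorem u_possibleImages_pos (hU : U ≤ Units.posSubgroup ℚ) (i : Fin toyIndex.lstar) (vQ : toyIndex.VQ)
    {V : Set ((uShells p U).Packet (Setting.labelSucc i) vQ)} (hV : V ∈ (uSetting p U).possibleImages (Setting.labelSucc i) vQ) :
    ∃ a : ℚ, 0 < a ∧ V = uHalf p U _ vQ a := by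
  obtain ⟨Φ, hΦ, rfl⟩ := hV
  obtain ⟨u, hu, hΦc⟩ := (ScalarShells.actsByScalars_of_mem_closure hΦ).scalar _ vQ
  have hu0 : (0 : ℚ) < u := (Units.mem_posSubgroup _).1 (hU hu)
  exact ⟨_, mul_pos hu0 (CandJoshi23.jsq_labelSucc_pos i), by rw [uSetting_thetaRegion3, image_uHalf_of_line_eq p U _ hu0 hΦc]⟩

/-- **H_J3′ `ShellFilling` FAILS on VAL(U), every `U`**: the unit shell `H_0` at label `2` is a hull-set above the Θ-image `H_4` and inside the
integral structure `H_0`, but never a possible image. [claim: Joshi2021ATSII, status: disputed] -/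
theorem u_not_shellFilling (hU : U ≤ Units.posSubgroup ℚ) :
    ¬ CandJoshi3.ShellFilling (uFull p U).toLatticeSituation (uSetting p U) (uRho p U) := fun h => by
  have h0 := h (Setting.labelSucc (⟨1, by decide⟩ : Fin toyIndex.lstar)) () (uHalf p U _ () 0) ⟨0, rfl⟩
    ⟨0, by rw [u_frobΨ, uRho_uPsi]; exact uHalf_anti p U (le_of_lt (CandJoshi23.jsq_labelSucc_pos _))⟩ subset_rfl
  obtain ⟨a, ha, h0a⟩ := u_possibleImages_pos p U hU _ () h0
  have := (uHalf_eq_iff p U).1 h0a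
  linarith

/-! ## 3. The Statement bit «U ≠ ⊥»: the local prototype, the licence, dominance, volume dominance, locus covering -/

/-- **H_J21-4 `JoshiLocalPrototype` on VAL(U) ⟺ `U ≠ ⊥`** (`⊥`: `−log p ≤ −4·log p` fails at label `2`; `U ≠ ⊥`: `−log p ≤ 0`).
[claim: Joshi2023ATS2Local, status: disputed] -/
theorem u_localPrototype_iff [Fact p.Prime] (hU : U ≤ Units.posSubgroup ℚ) : JoshiLocalPrototype (uSetting p U) ↔ U ≠ ⊥ := by
  constructor
  · intro h hb
    subst hb
    have h2 := h ⟨1, by decide⟩ ()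
    rw [EvalValUProfile.valU_qLocal, bot_thetaLocal] at h2
    have h4 : ((jsq (Setting.labelSucc (⟨1, by decide⟩ : Fin toyIndex.lstar)) : ℚ) : ℝ) = 4 := by exact_mod_cast jsq_two
    have hl := log_p_pos p
    have h2' : -Real.log p ≤ -(((jsq (Setting.labelSucc (⟨1, by decide⟩ : Fin toyIndex.lstar)) : ℚ) : ℝ)) * Real.log p := h2
    rw [h4] at h2'
    linarith
  · intro hne i vQ
    rw [EvalValUProfile.valU_qLocal, ne_bot_thetaLocal p U hU hne]
    have := log_p_pos p
    show -Real.log p ≤ (0 : ℝ)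
    linarith

/-- **The `Licence` («q-pilot region ⊆ ^{n,∘}𝒰 at every label of 𝔽_l^⋇») on VAL(U) ⟺ `U ≠ ⊥`** (`⊥`: `H_1 ⊄ H_4`; `U ≠ ⊥`: `H_1 ⊆ H_0`).
[claim: Mochizuki2012, status: disputed] -/
theorem u_licence_iff (hU : U ≤ Units.posSubgroup ℚ) : Thm311ToCor312.Licence (uSetting p U) ↔ U ≠ ⊥ := by
  constructor
  · intro h hb
    subst hb
    have h2 := h ⟨1, by decide⟩ ()
    rw [uSetting_qRegion, if_neg (Setting.labelSucc_ne_zero _), bot_thetaHull] at h2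
    exact uHalf_one_not_subset_four p ⊥ h2
  · intro hne i vQ
    rw [uSetting_qRegion, if_neg (Setting.labelSucc_ne_zero i), ne_bot_thetaHull p U hU hne]
    exact uHalf_anti p U zero_le_one

/-- **`GapH3` on VAL(U) ⟺ `U ≠ ⊥`** (the pins hold). [claim: Mochizuki2012, status: disputed] -/
theorem u_gapH3_iff (hU : U ≤ Units.posSubgroup ℚ) :
    GapH3 (uFull p U).toLatticeSituation (uSetting p U) (uRho p U) (uQDatum p U) ↔ U ≠ ⊥ := by
  rw [← u_licence_iff p U hU]
  exact ⟨fun h => h (u_pinnedRegions3 p U hU), fun h _ => h⟩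

/-- `j² ≤ 4` on the labels of `toyIndex` (`l⋇ = 2`). [folklore] -/
theorem jsq_le_four (j : toyIndex.Label) : ((jsq j : ℤ) : ℚ) ≤ 4 := by
  have hj : (j : ℕ) ≤ 2 := Nat.lt_succ_iff.1 j.2
  unfold jsq
  have : (j : ℕ) ^ 2 ≤ 2 ^ 2 := Nat.pow_le_pow_left hj 2
  exact_mod_cast this

variable {U} in
/-- A nontrivial subgroup of positive scalars contains a scalar `≤ ¼`. [folklore] -/
theorem exists_mul_four_le_one (hU : U ≤ Units.posSubgroup ℚ) (hne : U ≠ ⊥) : ∃ u ∈ U, ((u : ℚˣ) : ℚ) * 4 ≤ 1 := by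
  obtain ⟨u, hu, hu1⟩ := exists_lt_one hne
  have hu0 : (0 : ℚ) < u := (Units.mem_posSubgroup _).1 (hU hu)
  obtain ⟨n, hn⟩ := exists_pow_lt_of_lt_one (show (0 : ℚ) < 4⁻¹ by norm_num) hu1
  refine ⟨u ^ n, U.pow_mem hu n, ?_⟩
  rw [Units.val_pow_eq_pow_val]
  have := hn.le
  have h4 : (u : ℚ) ^ n * 4 ≤ 4⁻¹ * 4 := mul_le_mul_of_nonneg_right this (by norm_num)
  rwa [inv_mul_cancel₀ (by norm_num : (4 : ℚ) ≠ 0)] at h4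

/-- **H_J1 `JoshiDominance` (abc-iut-rp-j1) on VAL(U) ⟺ `U ≠ ⊥`**: at `⊥` the only translate of `H_4` is `H_4 ⊉ H_1`; for `U ≠ ⊥` a scalar
`u ≤ ¼` of `U` gives `H_1 ⊆ H_{u·j²}` at every label (`j² ≤ 4`). [claim: Joshi2024ATSIII, status: disputed] -/
theorem u_joshiDominance_iff (hU : U ≤ Units.posSubgroup ℚ) :
    CandJoshi1.JoshiDominance (uFull p U).toLatticeSituation (uSetting p U) (uRho p U) (uQDatum p U) ↔ U ≠ ⊥ := by
  constructor
  · intro h hb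
    obtain ⟨Φ, hΦ, m, hm⟩ := h 2 ()
    rw [u_frobΨ, uRho_uPsi, uRho_uQDatum, if_neg two_ne_zero_label, image_uHalf_eq_self_of_bot p hb hΦ] at hm
    exact uHalf_one_not_subset_four p U hm
  · intro hne j vQ
    obtain ⟨u, hu, hu4⟩ := exists_mul_four_le_one hU hne
    have hu0 : (0 : ℚ) < u := (Units.mem_posSubgroup _).1 (hU hu)
    refine ⟨uHead p U fun _ => u, uHead_mem_closure fun _ => hu, 0, ?_⟩
    rw [u_frobΨ, uRho_uPsi, uRho_uQDatum, image_uHalf_uHead_const p U hu0]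
    refine uHalf_anti p U ?_
    split_ifs with hj
    · subst hj; rw [CandJoshi23.jsq_zero_cast, mul_zero]
    · have := jsq_le_four j
      nlinarith

/-- **H_J2 `JoshiVolumeDominance` on VAL(U) ⟺ `U ≠ ⊥`** (⟸ rp-j1's `joshiVolumeDominance_of_joshiDominance` under BridgeHyps + pins; ⟹ its
`statement_of_joshiVolumeDominance` and `bot_not_statement`). [claim: Joshi2024ATSIII, status: disputed] -/
theorem u_joshiVolumeDominance_iff [Fact p.Prime] (hU : U ≤ Units.posSubgroup ℚ) :
    CandJoshi1.JoshiVolumeDominance (uSetting p U) ↔ U ≠ ⊥ := by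
  constructor
  · intro h hb
    subst hb
    exact bot_not_statement p (CandJoshi1.statement_of_joshiVolumeDominance _ (u_bridgeHyps p ⊥ bot_le) h)
  · intro hne
    exact CandJoshi1.joshiVolumeDominance_of_joshiDominance _ _ _ _ (u_bridgeHyps p U hU) (u_pinnedRegions3 p U hU).1
      ((u_joshiDominance_iff p U hU).2 hne)

/-- **H_J3 `LocusCovers` (abc-iut-rp-j1) on VAL(U) ⟺ `U ≠ ⊥`** (`⊥`: the locus at label `2` is `H_4 ⊉ H_1`; `U ≠ ⊥`: the locus is `{v > 0}
⊇ H_1`, and `H_0` at the junk label). [claim: Joshi2021ATSII, status: disputed] -/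
theorem u_locusCovers_iff (hU : U ≤ Units.posSubgroup ℚ) :
    CandJoshi3.LocusCovers (uFull p U).toLatticeSituation (uSetting p U) (uRho p U) (uQDatum p U) ↔ U ≠ ⊥ := by
  constructor
  · intro h hb
    subst hb
    have h2 := h (Setting.labelSucc (⟨1, by decide⟩ : Fin toyIndex.lstar)) ()
    rw [uRho_uQDatum, if_neg (Setting.labelSucc_ne_zero _), bot_sUnion_possibleImages] at h2
    exact uHalf_one_not_subset_four p ⊥ h2
  · intro hne j vQ
    rw [uRho_uQDatum]
    rcases Fin.eq_zero_or_eq_succ j with rfl | ⟨i, rfl⟩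
    · rw [if_pos rfl]
      refine Set.subset_sUnion_of_subset _ ((uSetting p U).thetaRegion3 0 vQ) ?_ ((uSetting p U).thetaRegion3_mem_possibleImages 0 vQ)
      rw [uSetting_thetaRegion3, CandJoshi23.jsq_zero_cast]
    · rw [show (Fin.succ i : toyIndex.Label) = Setting.labelSucc i from rfl, if_neg (Setting.labelSucc_ne_zero i),
        ne_bot_sUnion_possibleImages p U hU hne]
      intro x hx
      show 0 < line _ vQ x
      exact lt_of_lt_of_le one_pos (mem_uHalf.1 hx)

/-! ## 4. The column, packaged: two bits -/

/-- **`u_column_two_bits` — THE CLASS-(iii) COLUMN ON THE VALUE CHART IS TWO BITS OF THE SCALAR GROUP.** For every `U ≤ ℚˣ` of positive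
scalars: (RESIDUAL BIT) S ⟺ C ⟺ H_J21-2 ⟺ GapA3 ⟺ `¼ ∈ U`; (STATEMENT BIT) Statement ⟺ Licence ⟺ GapH3 ⟺ H_J21-4 ⟺ H_J1 ⟺ H_J2 ⟺ H_J3 ⟺
H_J21-5 ⟺ ¬(Step (x) invariance) ⟺ `U ≠ ⊥`; (NO BIT) H_J21-1 ✗, H_J21-3 ✗, VolumePinned ✗, ShellFilling ✗, typed Thm. 3.11 ✓, pins ✓,
BridgeHyps ✓. [claim: Joshi2023ATS2Local, status: disputed] -/
theorem u_column_two_bits [Fact p.Prime] (hU : U ≤ Units.posSubgroup ℚ) :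
    ((PilotKummerIndRelated (uFull p U).toLatticeSituation (uSetting p U) (uRho p U) (uQDatum p U) ↔ CandJoshi23.quarter ∈ U) ∧
      (PilotKummerCompat (uFull p U).toLatticeSituation (uSetting p U) (uQDatum p U) ↔ CandJoshi23.quarter ∈ U) ∧
      (JoshiScalingIndeterminacy (uFull p U).toLatticeSituation (uSetting p U) (uQDatum p U) ↔ CandJoshi23.quarter ∈ U) ∧
      (GapA3 (uFull p U).toLatticeSituation (uSetting p U) (uRho p U) (uQDatum p U) ↔ CandJoshi23.quarter ∈ U)) ∧
    (((uSetting p U).Statement ↔ U ≠ ⊥) ∧ (Thm311ToCor312.Licence (uSetting p U) ↔ U ≠ ⊥) ∧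
      (GapH3 (uFull p U).toLatticeSituation (uSetting p U) (uRho p U) (uQDatum p U) ↔ U ≠ ⊥) ∧
      (JoshiLocalPrototype (uSetting p U) ↔ U ≠ ⊥) ∧
      (CandJoshi1.JoshiDominance (uFull p U).toLatticeSituation (uSetting p U) (uRho p U) (uQDatum p U) ↔ U ≠ ⊥) ∧
      (CandJoshi1.JoshiVolumeDominance (uSetting p U) ↔ U ≠ ⊥) ∧
      (CandJoshi3.LocusCovers (uFull p U).toLatticeSituation (uSetting p U) (uRho p U) (uQDatum p U) ↔ U ≠ ⊥) ∧
      (JoshiNonIsometricIndeterminacy (uSituation p U) (uSetting p U).n ↔ U ≠ ⊥) ∧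
      (¬ (uData p U).LogvolInvariant ↔ U ≠ ⊥)) ∧
    (¬ JoshiAnsatzQReading (uFull p U).toLatticeSituation (uSetting p U) (uRho p U) (uQDatum p U) ∧
      ¬ JoshiTopNormalized (uFull p U).toLatticeSituation (uSetting p U) (uRho p U) (uQDatum p U) ∧
      ¬ VolumePinned (uFull p U).toLatticeSituation (uSetting p U) (uRho p U) (uQDatum p U) ∧
      ¬ CandJoshi3.ShellFilling (uFull p U).toLatticeSituation (uSetting p U) (uRho p U) ∧
      (uFull p U).Statement ∧ PinnedRegions3 (uFull p U).toLatticeSituation (uSetting p U) (uRho p U) (uQDatum p U) ∧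
      BridgeHyps (uSetting p U)) :=
  ⟨⟨u_residual_iff p U hU, u_pilotKummerCompat_iff p U, u_H2_iff p U, u_gapA3_iff p U hU⟩,
    ⟨u_statement_iff p U hU, u_licence_iff p U hU, u_gapH3_iff p U hU, u_localPrototype_iff p U hU, u_joshiDominance_iff p U hU,
      u_joshiVolumeDominance_iff p U hU, u_locusCovers_iff p U hU, u_H5_iff p U hU _,
      by rw [u_logvolInvariant_iff p U hU]⟩,
    ⟨u_not_ansatzQReading p U, u_not_topNormalized p U, u_not_volumePinned p U, u_not_shellFilling p U hU, uFull_statement p U,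
      u_pinnedRegions3 p U hU, u_bridgeHyps p U hU⟩⟩

/-- **The intermediate suppliers side with the IDLE Statement, not with the residual**: on `U = ⟨16⟩` (non-isometric, `¼ ∉ U`) H_J1, H_J2,
H_J3, H_J21-4, the Licence and the typed Statement all HOLD while S, C and GapA3 FAIL. [claim: Joshi2024ATSIII, status: disputed] -/
theorem sixteen_intermediate_cells [Fact p.Prime] :
    CandJoshi1.JoshiDominance (uFull p (Subgroup.zpowers sixteen)).toLatticeSituation (uSetting p _) (uRho p _) (uQDatum p _) ∧
      CandJoshi1.JoshiVolumeDominance (uSetting p (Subgroup.zpowers sixteen)) ∧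
      CandJoshi3.LocusCovers (uFull p (Subgroup.zpowers sixteen)).toLatticeSituation (uSetting p _) (uRho p _) (uQDatum p _) ∧
      JoshiLocalPrototype (uSetting p (Subgroup.zpowers sixteen)) ∧ Thm311ToCor312.Licence (uSetting p (Subgroup.zpowers sixteen)) ∧
      (uSetting p (Subgroup.zpowers sixteen)).Statement ∧
      ¬ PilotKummerIndRelated (uFull p (Subgroup.zpowers sixteen)).toLatticeSituation (uSetting p _) (uRho p _) (uQDatum p _) ∧
      ¬ PilotKummerCompat (uFull p (Subgroup.zpowers sixteen)).toLatticeSituation (uSetting p _) (uQDatum p _) ∧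
      ¬ GapA3 (uFull p (Subgroup.zpowers sixteen)).toLatticeSituation (uSetting p _) (uRho p _) (uQDatum p _) := by
  obtain ⟨-, -, -, h16, hne, hq⟩ := four_sixteen_facts
  exact ⟨(u_joshiDominance_iff p _ h16).2 hne, (u_joshiVolumeDominance_iff p _ h16).2 hne, (u_locusCovers_iff p _ h16).2 hne,
    (u_localPrototype_iff p _ h16).2 hne, (u_licence_iff p _ h16).2 hne, ne_bot_statement p _ h16 hne,
    fun h => hq ((u_residual_iff p _ h16).1 h), fun h => hq ((u_pilotKummerCompat_iff p _).1 h), fun h => hq ((u_gapA3_iff p _ h16).1 h)⟩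

end Summit.ABC.IUTFork.Repair.CandJoshi24

end
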